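import Literature.Probability.LatticeModels.FreeBoundaryReflectionPositivity
import Literature.Probability.LatticeModels.MessagerMiracleSole

/-!
# Reflection positivity of the `+`-boundary finite-volume Ising states on symmetric volumes
(crux `PerfectScreening.SubharmonicOffOrigin`, stmt-CriticalPhenomena-1341; line
`certified-core-eventual-tail`, helper of the stub `stub_plusState_feasible`; registered sub-goal
`plusRP_zd_sites`)

The soundness stub of the line needs reflection positivity of the PLUS state `⟨·⟩⁺_{β,0}` of `ℤ³`
in the four lattice mirror types for EVERY `β ≥ 0`; the tree has it only through the FREE
finite-volume states (`isingExpect_free_reflect_mul_self_nonneg`, `…_of_cross`), whose box limit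
is the plus state only when `m*(β) = 0`. Here the finite-volume statement is proved for the `+`
boundary condition on `θ`-stable volumes `Λ` of a locally finite graph with an involutive
automorphism `θ` (Fröhlich–Israel–Lieb–Simon 1978, §2 / Thm. 3.1; Friedli–Velenik 2017,
Lemmas 10.7–10.8, Examples 10.9–10.10 — the proof is insensitive to a reflection-invariant boundary
field, cf. Hegerfeldt 1977, p. 263): the interacting edge set `ℰ^b_Λ` (boundary spins frozen to
`+1` enter through it) is `θ`-invariant, so `-βH⁺_Λ = a + a∘θ*` (sites;
`plusRP_hamiltonian_decomp_sites`), resp. `+ β Σ_{x∈C} σ_xσ_{θx}` over the feet of the bisected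
bonds (bonds; `plusRP_hamiltonian_decomp_bonds`), with `a` depending only on the spins in the
positive half; gluing with the constant `+` configuration commutes with `θ`, and the counting
reflection positivity on `{±1}^Λ` (`sum_conj_reflect_mul_re_nonneg`) gives
`0 ≤ ⟨(F∘θ*)·F⟩⁺_{Λ;β,h}` for half-local `F` (`plusRP_sum_isingWeight_nonneg`,
`plusRP_isingExpect_reflect_mul_self_nonneg` for sites and any `β, h`, `…_of_cross` for bonds and
`β ≥ 0`; `plusRP_zd_sites` is the `ℤ^d` specialisation).

References: J. Fröhlich, R. Israel, E. H. Lieb, B. Simon, Comm. Math. Phys. 62 (1978) 1–34;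
S. Friedli, Y. Velenik, *Statistical Mechanics of Lattice Systems* (CUP 2017), §10.3;
M. Biskup, LNM 1970 (2009), Lemma 5.3; G. C. Hegerfeldt, Comm. Math. Phys. 57 (1977).
No definitions are introduced.
-/

noncomputable section

open MeasureTheory Finset
open scoped ComplexConjugate
open Literature.Probability.LatticeModels

namespace Summit.CriticalPhenomena.Ising3DConformalLimit.Theorems.PerfectScreening.Ccet

section FiniteVolume

variable {V : Type*} [DecidableEq V] (G : SimpleGraph V) [G.LocallyFinite]

omit [DecidableEq V] [G.LocallyFinite] in
/-- An involutive map preserving adjacency is a graph automorphism (adjacency is reflected too). -/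
theorem plusRP_adj_iff (θ : V ≃ V) (hθ : Function.Involutive θ)
    (hθG : ∀ x y, G.Adj x y → G.Adj (θ x) (θ y)) (x y : V) :
    G.Adj (θ x) (θ y) ↔ G.Adj x y :=
  ⟨fun h => by simpa only [hθ x, hθ y] using hθG _ _ h, hθG x y⟩

/-- **Half-space decomposition of the `+`-boundary Hamiltonian, reflection through sites**: for an
involutive automorphism `θ` of `G`, a `θ`-stable finite volume `Λ` and a half `P` with `V = P ∪ θP`
and every edge inside `P` or inside `θP`, `-βH⁺_{Λ;h} = a + a∘θ*` with `a` depending only on the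
spins in `P` (plane edges/sites shared with weight `½`; Friedli–Velenik 2017, Example 10.9). -/
theorem plusRP_hamiltonian_decomp_sites (θ : V ≃ V) (hθ : Function.Involutive θ)
    (hθG : ∀ x y, G.Adj x y → G.Adj (θ x) (θ y)) {Λ : Finset V}
    (hΛ : ∀ x, x ∈ Λ ↔ θ x ∈ Λ) {P : Set V} (H1 : ∀ x, x ∈ P ∨ θ x ∈ P)
    (H3 : ∀ x y, G.Adj x y → (x ∈ P ∧ y ∈ P) ∨ (θ x ∈ P ∧ θ y ∈ P)) (β h : ℝ) :
    ∃ a : SpinConfig V → ℝ, (∀ σ τ : SpinConfig V, (∀ x ∈ P, σ x = τ x) → a σ = a τ) ∧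
      ∀ σ, -β * isingHamiltonian G Λ h .plus σ = a σ + a (σ ∘ θ) := by
  classical
  have hadj := plusRP_adj_iff G θ hθ hθG
  let ρ : Sym2 V → ℝ := fun e =>
    ((if ∀ x ∈ e, x ∈ P then 1 else 0) + if ∀ x ∈ e, θ x ∈ P then 0 else 1) / 2
  let ρ' : V → ℝ := fun x => ((if x ∈ P then 1 else 0) + if θ x ∈ P then 0 else 1) / 2
  have hρ : ∀ e, ρ e + ρ (e.map θ) = 1 := fun e => by
    simp only [ρ, sym2_forall_mem_map_iff, hθ _]; split_ifs <;> norm_num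
  have hρ' : ∀ x, ρ' x + ρ' (θ x) = 1 := fun x => by
    simp only [ρ', hθ x]; split_ifs <;> norm_num
  set E := edgesTouching G Λ with hEdef
  have hEθ : ∀ e ∈ E, e.map θ ∈ E := fun e he =>
    (mem_interactionEdges_map_iff G θ hadj hΛ .plus e).1 he
  have hE3 : ∀ e ∈ E, (∀ x ∈ e, x ∈ P) ∨ ∀ x ∈ e, θ x ∈ P := by
    intro e he
    have he' : e ∈ G.edgeSet := (mem_edgesTouching_iff.1 he).1
    revert he'
    induction e using Sym2.ind with
    | _ x y =>
      intro he'
      exact (H3 x y (by simpa using he')).imp (fun h => by simpa using h) fun h => by simpa using h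
  refine ⟨fun σ => β * ∑ e ∈ E, ρ e * bondSpin σ e + β * h * ∑ x ∈ Λ, ρ' x * spinAt x σ, ?_, ?_⟩
  · intro σ τ hστ
    have h1 : ∑ e ∈ E, ρ e * bondSpin σ e = ∑ e ∈ E, ρ e * bondSpin τ e := by
      refine Finset.sum_congr rfl fun e he => ?_
      by_cases hP : ∀ x ∈ e, x ∈ P
      · rw [bondSpin_congr fun x hx => hστ x (hP x hx)]
      · have hθP : ∀ x ∈ e, θ x ∈ P := (hE3 e he).resolve_left hP
        have h0 : ρ e = 0 := by simp only [ρ, if_neg hP, if_pos hθP]; norm_num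
        rw [h0, zero_mul, zero_mul]
    have h2 : ∑ x ∈ Λ, ρ' x * spinAt x σ = ∑ x ∈ Λ, ρ' x * spinAt x τ := by
      refine Finset.sum_congr rfl fun x _ => ?_
      by_cases hx : x ∈ P
      · simp [spinAt, hστ x hx]
      · have hθx : θ x ∈ P := (H1 x).resolve_left hx
        have h0 : ρ' x = 0 := by simp only [ρ', if_neg hx, if_pos hθx]; norm_num
        rw [h0, zero_mul, zero_mul]
    dsimp only
    rw [h1, h2]
  · intro σ
    have hsites : ∑ x ∈ Λ, ρ' x * spinAt x (σ ∘ θ) = ∑ x ∈ Λ, ρ' (θ x) * spinAt x σ :=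
      Finset.sum_equiv θ (fun x => hΛ x) (fun x _ => by rw [hθ x]; rfl)
    have hedges : ∑ e ∈ E, ρ e * bondSpin (σ ∘ θ) e = ∑ e ∈ E, ρ (e.map θ) * bondSpin σ e := by
      simp_rw [bondSpin_comp_equiv]
      refine Finset.sum_nbij' (fun e => e.map θ) (fun e => e.map θ) hEθ hEθ
        (fun e _ => ?_) (fun e _ => ?_) (fun e _ => ?_) <;>
        simp only [Sym2.map_map, hθ.comp_self, Sym2.map_id', id_eq]
    dsimp only
    simp only [isingHamiltonian, interactionEdges_plus]
    rw [← hEdef, hsites, hedges]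
    rw [show ∀ A B C D : ℝ, β * A + β * h * B + (β * C + β * h * D) =
      β * (A + C) + β * h * (B + D) from fun _ _ _ _ => by ring,
      ← Finset.sum_add_distrib, ← Finset.sum_add_distrib]
    simp_rw [← add_mul, hρ, hρ', one_mul]
    ring

/-- **Half-space decomposition of the `+`-boundary Hamiltonian, reflection through bonds**: for an
involutive automorphism `θ` of `G` exchanging the half `P` with its complement, every edge leaving
`P` being a bisected bond `{x, θx}`, and a `θ`-stable finite volume `Λ`,
`-βH⁺_{Λ;h} = a + a∘θ* + β Σ_{x ∈ C} σ_x σ_{θx}` with `a` depending only on the spins in `P` and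
`C ⊆ P ∩ Λ` the feet of the bisected bonds (Friedli–Velenik 2017, Example 10.10). -/
theorem plusRP_hamiltonian_decomp_bonds (θ : V ≃ V) (hθ : Function.Involutive θ)
    (hθG : ∀ x y, G.Adj x y → G.Adj (θ x) (θ y)) {Λ : Finset V}
    (hΛ : ∀ x, x ∈ Λ ↔ θ x ∈ Λ) {P : Set V} (hP : ∀ x, x ∈ P ↔ θ x ∉ P)
    (hcross : ∀ x y, G.Adj x y → x ∈ P → y ∉ P → y = θ x) (β h : ℝ) :
    ∃ (a : SpinConfig V → ℝ) (C : Finset V),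
      (∀ σ τ : SpinConfig V, (∀ x ∈ P, σ x = τ x) → a σ = a τ) ∧ (∀ x ∈ C, x ∈ P) ∧
      ∀ σ, -β * isingHamiltonian G Λ h .plus σ =
        a σ + a (σ ∘ θ) + β * ∑ x ∈ C, spinAt x σ * spinAt (θ x) σ := by
  classical
  have hadj := plusRP_adj_iff G θ hθ hθG
  have hPa : ∀ x ∈ P, θ x ∉ P := fun x hx => (hP x).1 hx
  have hPb : ∀ x, x ∉ P → θ x ∈ P := fun x hx => not_not.1 (mt (hP x).2 hx)
  set E := edgesTouching G Λ with hEdef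
  have hEθ : ∀ e, e ∈ E ↔ e.map θ ∈ E := fun e => mem_interactionEdges_map_iff G θ hadj hΛ .plus e
  let pP : Sym2 V → Prop := fun e => ∀ x ∈ e, x ∈ P
  let pN : Sym2 V → Prop := fun e => ∀ x ∈ e, x ∉ P
  have hpP : ∀ u v, pP s(u, v) ↔ u ∈ P ∧ v ∈ P := fun u v => by simp [pP]
  have hpN : ∀ u v, pN s(u, v) ↔ u ∉ P ∧ v ∉ P := fun u v => by simp [pN]
  let C : Finset V := Λ.filter fun x => x ∈ P ∧ G.Adj x (θ x)
  refine ⟨fun σ => β * ∑ e ∈ E.filter pP, bondSpin σ e +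
      β * h * ∑ x ∈ Λ.filter (· ∈ P), spinAt x σ, C, ?_, ?_, ?_⟩
  · intro σ τ hστ
    have h1 : ∑ e ∈ E.filter pP, bondSpin σ e = ∑ e ∈ E.filter pP, bondSpin τ e :=
      Finset.sum_congr rfl fun e he =>
        bondSpin_congr fun x hx => hστ x ((Finset.mem_filter.1 he).2 x hx)
    have h2 : ∑ x ∈ Λ.filter (· ∈ P), spinAt x σ = ∑ x ∈ Λ.filter (· ∈ P), spinAt x τ :=
      Finset.sum_congr rfl fun x hx => by
        simp only [spinAt, hστ x (Finset.mem_filter.1 hx).2]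
    dsimp only
    rw [h1, h2]
  · exact fun x hx => (Finset.mem_filter.1 hx).2.1
  · intro σ
    have hminus : ∑ e ∈ (E.filter fun e => ¬pP e).filter pN, bondSpin σ e =
        ∑ e ∈ E.filter pP, bondSpin (σ ∘ θ) e := by
      simp_rw [bondSpin_comp_equiv]
      symm
      refine Finset.sum_nbij' (fun e => e.map θ) (fun e => e.map θ) ?_ ?_ ?_ ?_ (fun e _ => rfl)
      · intro e he
        induction e using Sym2.ind with
        | _ x y =>
          rw [Finset.mem_filter, hpP] at he
          have hm : s(θ x, θ y) ∈ E := by simpa using (hEθ _).1 he.1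
          rw [Sym2.map_mk, Finset.mem_filter, Finset.mem_filter, hpP, hpN]
          exact ⟨⟨hm, fun hc => hPa x he.2.1 hc.1⟩, hPa x he.2.1, hPa y he.2.2⟩
      · intro e he
        induction e using Sym2.ind with
        | _ x y =>
          rw [Finset.mem_filter, Finset.mem_filter, hpN] at he
          have hm : s(θ x, θ y) ∈ E := by simpa using (hEθ _).1 he.1.1
          rw [Sym2.map_mk, Finset.mem_filter, hpP]
          exact ⟨hm, hPb x he.2.1, hPb y he.2.2⟩
      all_goals intro e _; simp only [Sym2.map_map, hθ.comp_self, Sym2.map_id', id_eq]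
    have hcrossE : ((E.filter fun e => ¬pP e).filter fun e => ¬pN e) =
        C.image fun x => s(x, θ x) := by
      ext e
      rw [Finset.mem_filter, Finset.mem_filter, Finset.mem_image]
      induction e using Sym2.ind with
      | _ u v =>
        rw [hpP, hpN]
        constructor
        · rintro ⟨⟨huv, hnP⟩, hnN⟩
          obtain ⟨he, z, hzΛ, hze⟩ := mem_edgesTouching_iff.1 huv
          have hadj' : G.Adj u v := by simpa using he
          by_cases hu : u ∈ P
          · have hv : v ∉ P := fun hv => hnP ⟨hu, hv⟩
            have hvθ : v = θ u := hcross u v hadj' hu hv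
            have huΛ : u ∈ Λ := by
              rcases Sym2.mem_iff.1 hze with rfl | rfl
              · exact hzΛ
              · exact (hΛ u).2 (hvθ ▸ hzΛ)
            refine ⟨u, Finset.mem_filter.2 ⟨huΛ, hu, ?_⟩, ?_⟩
            · rw [← hvθ]; exact hadj'
            · show s(u, θ u) = s(u, v)
              rw [hvθ]
          · have hv : v ∈ P := by_contra fun hv => hnN ⟨hu, hv⟩
            have huθ : u = θ v := hcross v u hadj'.symm hv hu
            have hvΛ : v ∈ Λ := by
              rcases Sym2.mem_iff.1 hze with rfl | rfl
              · exact (hΛ v).2 (huθ ▸ hzΛ)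
              · exact hzΛ
            refine ⟨v, Finset.mem_filter.2 ⟨hvΛ, hv, ?_⟩, ?_⟩
            · rw [← huθ]; exact hadj'.symm
            · show s(v, θ v) = s(u, v)
              rw [← huθ, Sym2.eq_swap]
        · rintro ⟨x, hx, hxe⟩
          obtain ⟨hxΛ, hxP, hxadj⟩ := Finset.mem_filter.1 hx
          have hθx : θ x ∉ P := hPa x hxP
          have hxE : s(x, θ x) ∈ E :=
            mem_edgesTouching_iff.2 ⟨(SimpleGraph.mem_edgeSet G).2 hxadj, x, hxΛ, Sym2.mem_mk_left _ _⟩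
          rw [Sym2.eq_iff] at hxe
          rcases hxe with ⟨rfl, rfl⟩ | ⟨rfl, rfl⟩
          · exact ⟨⟨hxE, fun hc => hθx hc.2⟩, fun hc => hc.1 hxP⟩
          · refine ⟨⟨?_, fun hc => hθx hc.1⟩, fun hc => hc.2 hxP⟩
            rw [Sym2.eq_swap]
            exact hxE
    have hinj : ∀ x ∈ C, ∀ y ∈ C, s(x, θ x) = s(y, θ y) → x = y := by
      intro x hx y hy hxy
      rcases Sym2.eq_iff.1 hxy with ⟨hxy, -⟩ | ⟨hxy, -⟩
      · exact hxy
      · exact absurd (hxy ▸ (Finset.mem_filter.1 hx).2.1 : θ y ∈ P)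
          (hPa y (Finset.mem_filter.1 hy).2.1)
    have hedges : ∑ e ∈ E, bondSpin σ e = ∑ e ∈ E.filter pP, bondSpin σ e +
        ∑ e ∈ E.filter pP, bondSpin (σ ∘ θ) e + ∑ x ∈ C, spinAt x σ * spinAt (θ x) σ := by
      rw [← Finset.sum_filter_add_sum_filter_not E pP,
        ← Finset.sum_filter_add_sum_filter_not (E.filter fun e => ¬pP e) pN, hminus, hcrossE,
        Finset.sum_image hinj, add_assoc]
      rfl
    have hsites : ∑ x ∈ Λ, spinAt x σ = ∑ x ∈ Λ.filter (· ∈ P), spinAt x σ +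
        ∑ x ∈ Λ.filter (· ∈ P), spinAt x (σ ∘ θ) := by
      rw [← Finset.sum_filter_add_sum_filter_not Λ (· ∈ P) fun x => spinAt x σ]
      congr 1
      symm
      refine Finset.sum_nbij' θ θ ?_ ?_ (fun x _ => hθ x) (fun x _ => hθ x) (fun x _ => rfl)
      · intro x hx
        simp only [Finset.mem_filter] at hx ⊢
        exact ⟨(hΛ x).1 hx.1, hPa x hx.2⟩
      · intro x hx
        simp only [Finset.mem_filter] at hx ⊢
        exact ⟨(hΛ x).1 hx.1, hPb x hx.2⟩
    dsimp only
    simp only [isingHamiltonian, interactionEdges_plus]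
    rw [← hEdef, hedges, hsites]
    ring

/-- **The common core.** If `-βH⁺_{Λ;h} = a + a∘θ* + κ Σ_{x ∈ C} σ_x σ_{θx}` with `a` depending
only on the spins in the half `P` (`V = P ∪ θP`, `θ = id` on `P ∩ θP`), `C ⊆ P` and `κ ≥ 0`, then
`0 ≤ Σ_ω e^{-βH⁺_Λ(ω·+)} F(θ*(ω·+)) F(ω·+)` for every real `P`-local `F` (sum over the
configurations of `Λ` glued with `+` outside): the weight expands as
`Σ_{S ⊆ C} sinh^{|S|}κ cosh^{|C∖S|}κ D_S (D_S∘θ*)`, `D_S = e^{a} Π_{x∈S} σ_x` `P`-local, and the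
counting measure on `{±1}^Λ` is reflection positive (Friedli–Velenik 2017, Lemmas 10.7–10.8). -/
theorem plusRP_sum_isingWeight_nonneg (θ : V ≃ V) (hθ : Function.Involutive θ)
    {Λ : Finset V} (hΛ : ∀ x, x ∈ Λ ↔ θ x ∈ Λ) {P : Set V} (H1 : ∀ x, x ∈ P ∨ θ x ∈ P)
    (H2 : ∀ x ∈ P, θ x ∈ P → θ x = x) {β h κ : ℝ} (hκ : 0 ≤ κ) {a : SpinConfig V → ℝ}
    {C : Finset V} (ha : ∀ σ τ : SpinConfig V, (∀ x ∈ P, σ x = τ x) → a σ = a τ)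
    (hC : ∀ x ∈ C, x ∈ P)
    (hH : ∀ σ, -β * isingHamiltonian G Λ h .plus σ =
      a σ + a (σ ∘ θ) + κ * ∑ x ∈ C, spinAt x σ * spinAt (θ x) σ)
    {F : SpinConfig V → ℝ} (hFP : DependsOn F P) :
    0 ≤ ∑ ω : SpinConfig ↥Λ, isingWeight G Λ β h .plus ω *
      (F (configReflect θ (glue Λ ω .plus)) * F (glue Λ ω .plus)) := by
  classical
  set θv : ↥Λ ≃ ↥Λ := volEquiv θ hΛ with hθv
  have hθvi : Function.Involutive θv := fun z => Subtype.ext (hθ z)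
  have hglue : ∀ ω : SpinConfig ↥Λ, glue Λ (ω ∘ θv) .plus = glue Λ ω .plus ∘ θ :=
    fun ω => glue_comp_volEquiv θ hΛ .plus (fun _ => rfl) ω
  have hcfg : ∀ ω : SpinConfig ↥Λ, configReflect θ (glue Λ ω .plus) = glue Λ ω .plus ∘ θ :=
    fun ω => rfl
  let P' : Set ↥Λ := {z | (z : V) ∈ P}
  have H1' : ∀ z : ↥Λ, z ∈ P' ∨ θv z ∈ P' := fun z => H1 z
  have H2' : ∀ z ∈ P', θv z ∈ P' → θv z = z := fun z hz hθz => Subtype.ext (H2 _ hz hθz)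
  have hagree : ∀ ω ω' : SpinConfig ↥Λ, (∀ z ∈ P', ω z = ω' z) →
      ∀ x ∈ P, glue Λ ω .plus x = glue Λ ω' .plus x := by
    intro ω ω' hω x hx
    by_cases hxΛ : x ∈ Λ
    · rw [glue_apply_of_mem _ _ _ hxΛ, glue_apply_of_mem _ _ _ hxΛ]
      exact hω ⟨x, hxΛ⟩ hx
    · rw [glue_apply_of_notMem _ _ _ hxΛ, glue_apply_of_notMem _ _ _ hxΛ]
  have hsinh : 0 ≤ Real.sinh κ := sinh_nonneg_of_nonneg' hκ
  let D : Finset V → SpinConfig V → ℝ := fun S σ => Real.exp (a σ) * ∏ x ∈ S, spinAt x σ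
  let c : Finset V → ℝ := fun S => Real.sinh κ ^ S.card * Real.cosh κ ^ (C \ S).card
  have hc : ∀ S, 0 ≤ c S := fun S =>
    mul_nonneg (pow_nonneg hsinh _) (pow_nonneg (Real.cosh_pos κ).le _)
  have hD_loc : ∀ S ∈ C.powerset, ∀ σ τ : SpinConfig V, (∀ x ∈ P, σ x = τ x) →
      D S σ = D S τ := by
    intro S hS σ τ hστ
    have hSP : ∀ x ∈ S, x ∈ P := fun x hx => hC x (Finset.mem_powerset.1 hS hx)
    simp only [D, ha σ τ hστ]
    congr 1
    exact Finset.prod_congr rfl fun x hx => by simp only [spinAt, hστ x (hSP x hx)]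
  have hw : ∀ σ, Real.exp (-β * isingHamiltonian G Λ h .plus σ) =
      ∑ S ∈ C.powerset, c S * (D S σ * D S (σ ∘ θ)) := by
    intro σ
    rw [hH σ, Real.exp_add, Real.exp_add, Finset.mul_sum, Real.exp_sum]
    have hfac : ∀ x ∈ C, Real.exp (κ * (spinAt x σ * spinAt (θ x) σ)) =
        Real.sinh κ * (spinAt x σ * spinAt (θ x) σ) + Real.cosh κ := fun x _ =>
      exp_mul_eq_sinh_mul_add_cosh κ (spinAt_mul_spinAt_eq_one_or x (θ x) σ σ)
    rw [Finset.prod_congr rfl hfac, Finset.prod_add, Finset.mul_sum]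
    refine Finset.sum_congr rfl fun S _ => ?_
    rw [Finset.prod_mul_distrib, Finset.prod_mul_distrib, Finset.prod_const, Finset.prod_const]
    have hprod : ∏ x ∈ S, spinAt (θ x) σ = ∏ x ∈ S, spinAt x (σ ∘ θ) := rfl
    rw [hprod]
    dsimp only [D, c]
    ring
  have key : ∑ ω : SpinConfig ↥Λ, isingWeight G Λ β h .plus ω *
      (F (configReflect θ (glue Λ ω .plus)) * F (glue Λ ω .plus)) =
      ∑ S ∈ C.powerset, c S * ∑ ω : SpinConfig ↥Λ,
        (D S (glue Λ ω .plus ∘ θ) * F (glue Λ ω .plus ∘ θ)) *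
          (D S (glue Λ ω .plus) * F (glue Λ ω .plus)) := by
    calc _ = ∑ ω : SpinConfig ↥Λ, ∑ S ∈ C.powerset, c S *
          ((D S (glue Λ ω .plus ∘ θ) * F (glue Λ ω .plus ∘ θ)) *
            (D S (glue Λ ω .plus) * F (glue Λ ω .plus))) := by
          refine Finset.sum_congr rfl fun ω _ => ?_
          rw [isingWeight, hw, hcfg, Finset.sum_mul]
          refine Finset.sum_congr rfl fun S _ => ?_
          ring
      _ = _ := by
          rw [Finset.sum_comm]
          refine Finset.sum_congr rfl fun S _ => ?_
          rw [Finset.mul_sum]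
  rw [key]
  refine Finset.sum_nonneg fun S hS => mul_nonneg (hc S) ?_
  let Gc : SpinConfig ↥Λ → ℂ := fun ω => ((D S (glue Λ ω .plus) * F (glue Λ ω .plus) : ℝ) : ℂ)
  have hGc : ∀ ω ω' : SpinConfig ↥Λ, (∀ z ∈ P', ω z = ω' z) → Gc ω = Gc ω' := by
    intro ω ω' hω
    have hPω := hagree ω ω' hω
    simp only [Gc, hD_loc S hS _ _ hPω, hFP hPω]
  have h0 := sum_conj_reflect_mul_re_nonneg θv hθvi P' H1' H2' Gc hGc
  have hre : (∑ ω : SpinConfig ↥Λ, conj (Gc (ω ∘ θv)) * Gc ω).re =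
      ∑ ω : SpinConfig ↥Λ, (D S (glue Λ ω .plus ∘ θ) * F (glue Λ ω .plus ∘ θ)) *
        (D S (glue Λ ω .plus) * F (glue Λ ω .plus)) := by
    rw [Complex.re_sum]
    refine Finset.sum_congr rfl fun ω _ => ?_
    simp only [Gc, hglue, Complex.conj_ofReal, ← Complex.ofReal_mul, Complex.ofReal_re]
  rw [hre] at h0
  exact h0

/-- **`+`-boundary finite volumes are reflection positive through sites**: for an involutive
automorphism `θ` of `G`, a `θ`-stable finite volume `Λ`, a half `P` in the site position
(`V = P ∪ θP`, `θ = id` on `P ∩ θP`, every edge inside `P` or inside `θP`) and a measurable real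
`P`-local `F`, `0 ≤ ⟨(F ∘ θ*) · F⟩⁺_{Λ;β,h}` for all real `β, h` (FILS 1978, Thm. 3.1;
Friedli–Velenik 2017, Lemma 10.8 with the reflection-invariant `+` boundary field). -/
theorem plusRP_isingExpect_reflect_mul_self_nonneg (θ : V ≃ V) (hθ : Function.Involutive θ)
    (hθG : ∀ x y, G.Adj x y → G.Adj (θ x) (θ y)) {Λ : Finset V} (hΛ : ∀ x, x ∈ Λ ↔ θ x ∈ Λ)
    {P : Set V} (H1 : ∀ x, x ∈ P ∨ θ x ∈ P) (H2 : ∀ x ∈ P, θ x ∈ P → θ x = x)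
    (H3 : ∀ x y, G.Adj x y → (x ∈ P ∧ y ∈ P) ∨ (θ x ∈ P ∧ θ y ∈ P)) (β h : ℝ)
    {F : SpinConfig V → ℝ} (hFm : Measurable F) (hFP : DependsOn F P) :
    0 ≤ isingExpect G Λ β h .plus (fun τ => F (configReflect θ τ) * F τ) := by
  obtain ⟨a, ha, hH⟩ := plusRP_hamiltonian_decomp_sites G θ hθ hθG hΛ H1 H3 β h
  have hf : Measurable fun τ => F (configReflect θ τ) * F τ :=
    (hFm.comp (measurable_configReflect θ)).mul hFm
  rw [isingExpect, integral_isingMeasure G Λ β h _ hf]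
  refine div_nonneg ?_ (isingPartitionFunction_pos G Λ β h _).le
  refine plusRP_sum_isingWeight_nonneg G θ hθ hΛ H1 H2 (κ := 0) le_rfl (C := ∅) ha
    (fun x hx => absurd hx (Finset.notMem_empty x)) (fun σ => ?_) hFP
  rw [hH σ, Finset.sum_empty, mul_zero, add_zero]

/-- **`+`-boundary finite volumes are reflection positive through bonds (`β ≥ 0`)**: as
`plusRP_isingExpect_reflect_mul_self_nonneg`, for a half `P` in the bond position (`P`, `θP`
partition `V`, every edge leaving `P` joins `x` to `θx`) (FILS 1978; Friedli–Velenik 2017,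
Lemma 10.8 / Example 10.10 with the `+` boundary field). -/
theorem plusRP_isingExpect_reflect_mul_self_nonneg_of_cross (θ : V ≃ V)
    (hθ : Function.Involutive θ) (hθG : ∀ x y, G.Adj x y → G.Adj (θ x) (θ y)) {Λ : Finset V}
    (hΛ : ∀ x, x ∈ Λ ↔ θ x ∈ Λ) {P : Set V} (hP : ∀ x, x ∈ P ↔ θ x ∉ P)
    (hcross : ∀ x y, G.Adj x y → x ∈ P → y ∉ P → y = θ x) {β : ℝ} (hβ : 0 ≤ β) (h : ℝ)
    {F : SpinConfig V → ℝ} (hFm : Measurable F) (hFP : DependsOn F P) :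
    0 ≤ isingExpect G Λ β h .plus (fun τ => F (configReflect θ τ) * F τ) := by
  obtain ⟨a, C, ha, hC, hH⟩ := plusRP_hamiltonian_decomp_bonds G θ hθ hθG hΛ hP hcross β h
  have H1 : ∀ x, x ∈ P ∨ θ x ∈ P := fun x => (em (x ∈ P)).imp_right fun hx => not_not.1 (mt (hP x).2 hx)
  have H2 : ∀ x ∈ P, θ x ∈ P → θ x = x := fun x hx hθx => absurd hθx ((hP x).1 hx)
  have hf : Measurable fun τ => F (configReflect θ τ) * F τ :=
    (hFm.comp (measurable_configReflect θ)).mul hFm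
  rw [isingExpect, integral_isingMeasure G Λ β h _ hf]
  refine div_nonneg ?_ (isingPartitionFunction_pos G Λ β h _).le
  exact plusRP_sum_isingWeight_nonneg G θ hθ hΛ H1 H2 hβ ha hC hH hFP

end FiniteVolume

/-! ### The `ℤ^d` specialisation (registered sub-goal) -/

/-- **Registered sub-goal `plusRP_zd_sites` of stmt-CriticalPhenomena-1341**: the `+`-boundary
finite-volume states of the nearest-neighbour Ising model on `ℤ^d` are reflection positive
through sites on every `θ`-stable finite volume, for every `β, h`
(`plusRP_isingExpect_reflect_mul_self_nonneg` on `zdGraph d`). -/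
theorem plusRP_zd_sites :
    ∀ {d : ℕ} (θ : Site d ≃ Site d), Function.Involutive θ →
      (∀ x y, (zdGraph d).Adj x y → (zdGraph d).Adj (θ x) (θ y)) →
      ∀ {Λ : Finset (Site d)}, (∀ x, x ∈ Λ ↔ θ x ∈ Λ) →
      ∀ {P : Set (Site d)}, (∀ x, x ∈ P ∨ θ x ∈ P) → (∀ x ∈ P, θ x ∈ P → θ x = x) →
      (∀ x y, (zdGraph d).Adj x y → (x ∈ P ∧ y ∈ P) ∨ (θ x ∈ P ∧ θ y ∈ P)) →
      ∀ (β h : ℝ) {F : SpinConfig (Site d) → ℝ}, Measurable F → DependsOn F P →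
        0 ≤ isingExpect (zdGraph d) Λ β h BoundaryCondition.plus
          (fun τ => F (configReflect θ τ) * F τ) :=
  fun θ hθ hθG _ hΛ _ H1 H2 H3 β h _ hFm hFP =>
    plusRP_isingExpect_reflect_mul_self_nonneg (zdGraph _) θ hθ hθG hΛ H1 H2 H3 β h hFm hFP

end Summit.CriticalPhenomena.Ising3DConformalLimit.Theorems.PerfectScreening.Ccet

end
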